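import Literature.AlgebraicGeometry.Modules.KernelFiniteLocallyFree
import Literature.AlgebraicGeometry.Modules.FinitePresentationLocal
import Literature.AlgebraicGeometry.Modules.FiniteTypeLocal
import Literature.AlgebraicGeometry.Modules.RestrictOpenCoh
import Literature.AlgebraicGeometry.Morphisms.CohOfVectorBundle
import Literature.AlgebraicGeometry.Morphisms.CohAffineExactness
import Literature.AlgebraicGeometry.KTheory.GrothendieckGroup
import Mathlib.Algebra.Module.FinitePresentation
import HarnessLib

/-!
# Coherent = finitely presented, on a locally noetherian scheme

Görtz–Wedhorn, *Algebraic Geometry I* (2nd ed.), Prop. 7.45 / Def. 7.44 with Prop. 7.26 (p. 197,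
p. 190): on a locally noetherian scheme an `𝒪_X`-module is coherent iff it is of finite
presentation iff it is quasi-coherent of finite type; on an affine open `Spec B` these are the
`M̃` with `M` finitely generated over the noetherian ring `B`. The tree's working notion of
coherence is `Coh M` = affine-localizing + affine-finite type
(`Literature.AlgebraicGeometry.Morphisms.Coh`); Mathlib's is
`SheafOfModules.IsFinitePresentation` (local finite presentations by free modules). This file proves
that they AGREE on locally noetherian schemes:

* `isFinitePresentation_tilde` — `M̃` is finitely presented for a finitely presented module `M`
  (Mathlib `presentationTilde` on finite generators and relations);
* `isFinitePresentation_of_coh` — **`Coh M → IsFinitePresentation M`**: on an affine open `V`,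
  `M|_{Spec Γ(X,V)} ≅ Γ(V, M)~` (`isLocalizing_restrict_fromSpec`, Mathlib `fromTildeΓ`) with
  `Γ(V, M)` finitely generated over the noetherian `Γ(V, 𝒪_X)`, and finite presentation is local
  (tree `isFinitePresentation_of_openCover`);
* `coh_of_isFinitePresentation` — **`IsFinitePresentation M → Coh M`**: finitely presented modules
  are quasi-coherent (Mathlib), hence affine-localizing; a finite presentation on an affine open
  gives finitely generated sections on the affine opens inside it (an epimorphism from a free module
  of finite rank, surjective on affine sections), and finite type is affine-local
  (`IsAffineFiniteType.of_basis`);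
* `coh_iff_isFinitePresentation`.

Everything is proved; no named facts.

## References

* U. Görtz, T. Wedhorn, *Algebraic Geometry I: Schemes*, 2nd ed. (2020), Prop. 7.26, Def. 7.44,
  Prop. 7.45. [GortzWedhorn2020]
* The Stacks Project, Tag 01XZ, Tag 01BN. [StacksProject]
-/

noncomputable section

-- `TopCat.Presheaf`/`Scheme.Modules` are not reducible (as in Mathlib's `AlgebraicGeometry/Modules`).
set_option backward.isDefEq.respectTransparency false

open CategoryTheory AlgebraicGeometry Limits TopologicalSpace Opposite

universe u

namespace Literature.AlgebraicGeometry.Modules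

open Literature.AlgebraicGeometry.Motives Literature.AlgebraicGeometry.Morphisms
  Literature.AlgebraicGeometry.KTheory

/-! ## `M̃` is finitely presented for `M` finitely presented -/

/-- **`M̃` has a finite global presentation for a finitely presented module `M`** (finitely many
generators, and finitely many generators of the module of relations; Mathlib `presentationTilde`).
[cite: GortzWedhorn2020, Prop 7.26] -/
theorem exists_presentation_tilde_isFinite {R : CommRingCat.{u}} (M : ModuleCat.{u} R)
    [Module.FinitePresentation R M] :
    ∃ P : SheafOfModules.Presentation (tilde M), P.IsFinite := by
  classical
  obtain ⟨T, hT⟩ := Module.Finite.fg_top (R := R) (M := M)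
  let s : Set M := ↑T
  have hs : Submodule.span R s = ⊤ := hT
  let l : (s →₀ R) →ₗ[R] M := Finsupp.linearCombination R ((↑) : s → M)
  have hl : Function.Surjective l := by
    rw [← LinearMap.range_eq_top, Finsupp.range_linearCombination, Subtype.range_coe_subtype]
    exact hs
  obtain ⟨T', hT'⟩ := Module.FinitePresentation.fg_ker l hl
  let t : Set (s →₀ R) := ↑T'
  have ht : Submodule.span R t = LinearMap.ker l := hT'
  refine ⟨presentationTilde M s hs t ht, ?_⟩
  exact
    { isFiniteType_generators := ⟨by
        change Finite s
        infer_instance⟩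
      isFiniteType_relations := ⟨by
        change Finite t
        infer_instance⟩ }

/-- `M̃` is finitely presented for `M` finitely presented. [cite: GortzWedhorn2020, Prop 7.26] -/
theorem isFinitePresentation_tilde {R : CommRingCat.{u}} (M : ModuleCat.{u} R)
    [Module.FinitePresentation R M] : SheafOfModules.IsFinitePresentation.{u, u, u} (tilde M) := by
  obtain ⟨P, hP⟩ := exists_presentation_tilde_isFinite M
  haveI := hP
  exact isFinitePresentation_of_presentation P

/-! ## `Coh → IsFinitePresentation` -/

section ToFinitePresentation

variable {X : Scheme.{u}} (M : X.Modules)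

/-- The global sections of `M|_{Spec Γ(X, V)}` are `Γ(V, M)`, linearly over `Γ(V, 𝒪_X)` (transport
along `fromSpec(⊤) = V`; as in the tree's `nonempty_free_iso_over_of_basis`). [folklore] -/
def appTopRestrictFromSpecEquiv {V : X.Opens} (hV : IsAffineOpen V) :
    Γ(M, V) ≃ₗ[Γ(X, V)] Γ(M.restrict hV.fromSpec, ⊤) :=
  { (M.presheaf.mapIso (eqToIso (fromSpec_image_top hV)).op).addCommGroupIsoToAddEquiv with
    map_smul' := fun r x => by
      change M.presheaf.map (eqToHom (fromSpec_image_top hV)).op (r • x) =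
        r • (show Γ(M.restrict hV.fromSpec, ⊤) from M.presheaf.map _ x)
      rw [restrict_fromSpec_smul_def, eqToHom_op,
        opens_op_hom_ext (eqToHom _) (homOfLE (fromSpec_image_le hV ⊤)).op]
      exact M.map_smul (homOfLE (fromSpec_image_le hV ⊤)) r x }

/-- **`M|_{Spec Γ(X, V)}` is finitely presented** for `M` coherent and `V` affine (`X` locally
noetherian): it is `Γ(V, M)~` with `Γ(V, M)` finitely generated over the noetherian `Γ(V, 𝒪_X)`.
[cite: GortzWedhorn2020, Prop 7.45] -/
theorem isFinitePresentation_restrict_fromSpec_of_coh [IsLocallyNoetherian X] (hM : Coh M)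
    {V : X.Opens} (hV : IsAffineOpen V) :
    SheafOfModules.IsFinitePresentation.{u, u, u} (M.restrict hV.fromSpec) := by
  let N := M.restrict hV.fromSpec
  haveI : IsIso N.fromTildeΓ :=
    (isIso_fromTildeΓ_iff_isLocalizing _).mpr (isLocalizing_restrict_fromSpec M hM.loc hV)
  haveI : IsNoetherianRing Γ(X, V) := IsLocallyNoetherian.component_noetherian ⟨V, hV⟩
  haveI : Module.Finite Γ(X, V) Γ(M, V) := hM.ft hV
  let P : ModuleCat.{u} Γ(X, V) := (modulesSpecToSheaf.obj N).presheaf.obj (op ⊤)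
  haveI : Module.Finite Γ(X, V) P :=
    Module.Finite.equiv (appTopRestrictFromSpecEquiv M hV)
  haveI : Module.FinitePresentation Γ(X, V) P := Module.finitePresentation_of_finite _ _
  exact isFinitePresentation_of_iso (asIso N.fromTildeΓ) (isFinitePresentation_tilde P)

/-- The open cover of `X` by the canonical charts `Spec Γ(X, V) → X` of its affine opens. [folklore] -/
def affineOpensCover (X : Scheme.{u}) : X.OpenCover :=
  Scheme.Cover.mkOfCovers X.affineOpens (fun V => Spec Γ(X, V)) (fun V => V.2.fromSpec) fun x => by
    obtain ⟨V, hV, hxV, -⟩ := Opens.isBasis_iff_nbhd.mp X.isBasis_affineOpens (Opens.mem_top x)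
    have hx : x ∈ Set.range (hV.fromSpec).base := by rw [hV.range_fromSpec]; exact hxV
    obtain ⟨y, hy⟩ := hx
    exact ⟨⟨V, hV⟩, y, hy⟩

/-- **A coherent module on a locally noetherian scheme is finitely presented.**
[cite: GortzWedhorn2020, Prop 7.45] -/
theorem isFinitePresentation_of_coh [IsLocallyNoetherian X] (hM : Coh M) :
    SheafOfModules.IsFinitePresentation.{u, u, u} M :=
  isFinitePresentation_of_openCover M (affineOpensCover X) fun V =>
    isFinitePresentation_restrict_fromSpec_of_coh M hM V.2

end ToFinitePresentation

/-! ## `IsFinitePresentation → Coh` -/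

section ToCoh

variable {X : Scheme.{u}} (M : X.Modules)

/-- **Finite generation of sections descends along restriction to an open subscheme**: if
`Γ(U, M|_{X'})` is finitely generated over `Γ(U, 𝒪_{X'})` for an open immersion `f : X' → X`, then
`Γ(f(U), M)` is finitely generated over `Γ(f(U), 𝒪_X)` (the identification `Γ(U, M|_{X'}) = Γ(f(U), M)`
is semilinear over `f♯ : Γ(f(U), 𝒪_X) ≅ Γ(U, 𝒪_{X'})`, Mathlib `smul_restrictAppIso_hom`). [folklore] -/
theorem moduleFinite_image_of_moduleFinite_restrict {X' : Scheme.{u}} (f : X' ⟶ X) [IsOpenImmersion f]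
    (U : X'.Opens) (h : Module.Finite Γ(X', U) Γ(M.restrict f, U)) :
    Module.Finite Γ(X, f ''ᵁ U) Γ(M, f ''ᵁ U) := by
  classical
  let e : Γ(M.restrict f, U) ≃+ Γ(M, f ''ᵁ U) := (M.restrictAppIso f U).addCommGroupIsoToAddEquiv
  have he : ∀ (r : Γ(X', U)) (y : Γ(M.restrict f, U)), e (r • y) = (f.appIso U).inv r • e y :=
    fun r y => Scheme.Modules.smul_restrictAppIso_hom_apply f M U r y
  obtain ⟨S, hS⟩ := h
  refine ⟨⟨S.image e, ?_⟩⟩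
  rw [eq_top_iff]
  rintro x -
  have hx : e.symm x ∈ Submodule.span Γ(X', U) (S : Set Γ(M.restrict f, U)) := by
    rw [hS]; trivial
  rw [← e.apply_symm_apply x]
  refine Submodule.span_induction (p := fun y _ => e y ∈ Submodule.span Γ(X, f ''ᵁ U) ↑(S.image e))
    (fun y hy => Submodule.subset_span ?_) (by rw [map_zero]; exact Submodule.zero_mem _)
    (fun y z _ _ hy hz => by rw [map_add]; exact Submodule.add_mem _ hy hz)
    (fun r y _ hy => by rw [he]; exact Submodule.smul_mem _ _ hy) hx
  rw [Finset.coe_image]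
  exact ⟨y, hy, rfl⟩

/-- A free module of finite rank is coherent (`X` locally noetherian). [folklore] -/
theorem coh_free [IsLocallyNoetherian X] (I : Type u) [Finite I] :
    Coh (SheafOfModules.free (R := X.ringCatSheaf) I) :=
  coh_of_isVectorBundle (KZero.isFiniteLocallyFree_free I).isVectorBundle

/-- **A finitely presented module on a locally noetherian scheme is coherent.** Affine-localizing:
finitely presented modules are quasi-coherent (Mathlib). Finite type: around each point there is an
affine open `U` carrying a finite presentation of `M|_U`, in particular an epimorphism `𝒪_U^I → M|_U`
with `I` finite, which is surjective on sections over the affine opens of `U`; and finite type is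
affine-local (`IsAffineFiniteType.of_basis`). [cite: GortzWedhorn2020, Prop 7.45] -/
theorem coh_of_isFinitePresentation [IsLocallyNoetherian X]
    (hM : SheafOfModules.IsFinitePresentation.{u, u, u} M) : Coh M := by
  haveI := hM
  have hloc : IsAffineLocalizing M := IsAffineLocalizing.of_isQuasicoherent M
  refine ⟨hloc, IsAffineFiniteType.of_basis hloc fun x O hxO => ?_⟩
  obtain ⟨ι, U, pres, hU, hUaff, hfin⟩ := exists_isOpenCover_finitePresentation M hM
  obtain ⟨i, hi⟩ := Opens.mem_iSup.mp (show x ∈ iSup U by rw [hU.iSup_eq_top]; trivial)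
  -- an affine open `W'` of the scheme `U i` around `x`, inside `O`
  obtain ⟨W', hW', hxW', hW'O⟩ := Opens.isBasis_iff_nbhd.mp (U i : Scheme.{u}).isBasis_affineOpens
    (show (⟨x, hi⟩ : (U i : Scheme.{u})) ∈ (U i).ι ⁻¹ᵁ O from hxO)
  refine ⟨(U i).ι ''ᵁ W', hW'.image_of_isOpenImmersion _, ⟨⟨x, hi⟩, hxW', rfl⟩, ?_, ?_⟩
  · rintro _ ⟨y, hy, rfl⟩
    exact hW'O hy
  · -- `Γ((U i).ι(W'), M) = Γ(W', M|_{U i})` is a quotient of `Γ(W', 𝒪^I)`, `I` finite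
    haveI := hfin i
    haveI : IsLocallyNoetherian (U i : Scheme.{u}) := inferInstance
    have hfree : Coh (SheafOfModules.free (R := (U i : Scheme.{u}).ringCatSheaf) (pres i).generators.I) :=
      coh_free _
    have hres : IsAffineLocalizing (M.restrict (U i).ι) := isAffineLocalizing_restrict _ M hloc
    haveI : Module.Finite Γ((U i : Scheme.{u}), W') Γ(SheafOfModules.free (pres i).generators.I, W') :=
      hfree.ft hW'
    let π' : @Quiver.Hom ((U i : Scheme.{u}).Modules) _
        (SheafOfModules.free (R := (U i : Scheme.{u}).ringCatSheaf) (pres i).generators.I)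
        (M.restrict (U i).ι) :=
      (pres i).generators.π
    haveI : Epi π' := ⟨fun g h w => (cancel_epi (pres i).generators.π).mp w⟩
    have hsurj : Function.Surjective (π'.app W') := app_surjective_of_epi π' hfree.loc hres hW'
    exact moduleFinite_image_of_moduleFinite_restrict M (U i).ι W'
      (Module.Finite.of_surjective (appLinear π' W') hsurj)

/-- **On a locally noetherian scheme, coherent = finitely presented.** [cite: GortzWedhorn2020, Prop 7.45] -/
theorem coh_iff_isFinitePresentation [IsLocallyNoetherian X] :
    Coh M ↔ SheafOfModules.IsFinitePresentation.{u, u, u} M :=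
  ⟨isFinitePresentation_of_coh M, coh_of_isFinitePresentation M⟩

end ToCoh

end Literature.AlgebraicGeometry.Modules

end
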